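import Summits.QuantumFields.BalabanUV.T4Continuum.Spine.NE4.Targets

/-!
# NODE N17 (NE4) — FILE 10: UNDER THE TRANSPORT READING ON RUNS, NODE U2's DOOR IS pv16's MARKOV DOOR — the N17 → N19′ rate edge (node U2's K-uniform coupling matching,
# `U2Output`) needs of the READ LAW only a Lipschitz constant in the CURRENT coupling and the Markov scale shift at fixed coupling; NO fading-memory companion, NO box letter on β's
# histories (`T4CouplingMatching.disc_le_of_lastOnly` ∕ `injectedRate_of_runs_lastOnly` BY NAME on the Markov family the runs read)

Cell `pub-ymgap`, YM-PLAN Track A (HUMAN RULINGS D-0062 ∕ D-0149), WIDTH SEAT `pub-ymgap-dag-n17-w1` (generation 6), CLAIM-5 ∕ INTENT-5.  Key K3⁸ stmt-QuantumFields-27366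
`SpineGivenEndpointR13SepCoPHV` (`--kind proof --supports stmt-QuantumFields-27366 --as helper`, COUNT-NEUTRAL).  Companion of FILE 7 p630045 `…N17TwoRunShiftFirstEntry` §2 (the transport
reading (T) ON RUNS: `β_k(g_0,…,g_k) = φ_k(g_k)` along in-window runs — [I] (0.20) p. 256's literal «β_{k+1}(g_k)») and of dag-n17-w3 g5's `…N17RunWindowShiftU2Door` (node U2's door from
the RUN-WINDOW N17 text, which still reads node U2's history ∕ memory companion).  Imports `Spine/NE4/Targets` only (no theses cone).

WHY.  The ym-nodeO F-E finding (CRIT-2 E-CRIT2-2 ∕ CRIT-1 g6 cross-read §1 ∕ §4(a)): modulo H_FE′ the bare-coupling history modulus of the record's β is the marginal-transport factor —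
bounded but NOT fading (`FadingMemory` presumptively false), so node U2's two-sided matching `T4CouplingMatching.disc_le_of_fadingMemory` (and every road through it: pv16 §5,
`Spine/NE4/Targets.u2Output_of_u2Inputs`, `Spine/NE4/Necessity.disc_le_of_shiftAlong_geom`, the rate-loss variants) has a dead companion at the current record — «the N17-rate road waits
for the F-E repair».  But modulo the transport identification (T) READ ON RUNS the runs of β ARE runs of the MARKOV family `ofMarkov (fun m g ↦ φ_{m−1}(g))` (§1), whose history modulus is
LAST-ONLY with the read law's Lipschitz constant in the CURRENT coupling (print's β_{k+1}(·) is smooth on [0,γ], [I] p. 264 — uniformly bounded derivative), and whose NE4 is the Markov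
scale shift at fixed coupling (pv16's `scaleShiftRate_ofMarkov_iff`).  pv16's literal Grönwall road `disc_le_of_lastOnly` (no fading memory, no smallness beyond `Lγ³ ≤ ½`, K-uniform by the
AF weight sum) then gives node U2's output.  So: F-E kills the BOX ∕ FADING road to node U2, (T) opens the MARKOV road — typed here BY NAME, nothing new proved about β.
WHAT (theorems only; 0 `def`, 0 `instance`, 0 `sorry`).  §1 `ofMarkov_pred_apply`; `rgEqH_ofMarkov_of_runReading` ((T) on runs ⟹ every in-window run of β is a run of the Markov family);
`lastOnlyLipschitz_ofMarkov_of_lipschitz`; `scaleShiftRate_ofMarkov_of_markovShift`; `eventualLowerH_ofMarkov_of_lower`.  §2 ★★ `disc_le_of_runReading_lipschitz_markovShift` (two IR-pinned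
in-window runs of β: `disc_j ≤ exp(2L·Σ_{m∈[j,K)}(g^A_m)²g^B_{m+1})·(c∕(1−θ))θ^j`); ★★★ `injectedRate_of_runs_runReading` (a pinned family of runs of β + eventual lower bound `b` of the read
law ⟹ `T4CauchySum.InjectedRate (exp(2L((k₀+1)γ³ + 2γ∕b))·c∕(1−θ)) 0 θ`, K-UNIFORM).  §3 ★★★ `u2Output_of_runReading` (ON THE DATA: (T) on the runs of `D.βfun` + the read law's letters +
a sequence tuned within `]0,γ]` + (0.20) run forward ⟹ `Spine.NE4.U2Output D g₀ (…) θ` — node U2's output, the N19′ edge's input, with NO `HistLipschitz` ∕ `FadingMemory` ∕ `ScaleShiftRate` on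
`D.βfun`'s histories).
HONEST SCOPE (A6).  Elementary bookkeeping over hypothesis SHAPES; (T)-on-runs, the Lipschitz ∕ scale-shift ∕ lower-bound letters of the read law, tuning and the printed-type upper bound
are BINDERS inhabited at no datum here; whether NODE 00's record admits the transport reading is the F-E repair desk's question (node00-def ∕ def-T, director-ym №210), NOT settled here;
NE4 NOT IN PRINT ([Balaban1987RG1] p. 264) and NOT proved in any keying; NOT a proof of any K3⁸ ∕ K1⁹ stub; N17 NOT discharged (DEPENDENT∕DERIVED row); K0⁷ ∕ K1⁹ ∕ K3⁸ OPEN; counts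
UNMOVED (typed 28∕28 · discharged 5∕27 · A 5∕28).  One finite four-torus programme at fixed `ε = L^{−K}`, Bałaban AS PRINTED; the YM mass gap (Clay) is NOT proved by any of this — R4
closes the conditional finite-𝕋⁴ rung `BalabanLadder.UV` only; nothing continuum ∕ ℝ⁴ ∕ OS.
[I] = [Balaban1987RG1] T. Bałaban, CMP **109** (1987): (0.20) p. 256, Thm 2 ∕ (0.31) p. 259, (1.20)–(1.22) p. 264, §1 p. 264, §5 p. 298.
-/

noncomputable section

namespace Summit.QuantumFields.YangMills.BalabanUVNodes.N17U2MarkovDoorOfRunReading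

open Literature.MathematicalPhysics.QuantumFieldTheory.Balaban1983to89
open Literature.MathematicalPhysics.QuantumFieldTheory.Balaban1983to89.FlowStep
open Literature.MathematicalPhysics.QuantumFieldTheory.Balaban1983to89.T4CouplingMatching
  (ScaleShiftRate LastOnlyLipschitz EventualLowerH disc disc_le_of_lastOnly injectedRate_of_runs_lastOnly scaleShiftRate_ofMarkov_iff)
open Literature.MathematicalPhysics.QuantumFieldTheory.Balaban1983to89.T4Continuum (T4Family FiniteEpsData)
open Literature.MathematicalPhysics.QuantumFieldTheory.Balaban1983to89.T4TwoRunUniqueness (rgEqH_of_tuned)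
open Summit.QuantumFields.BalabanUV.T4Continuum.Spine.NE4 (U2Output runFlow box_and_pin_of_tuned)
open Finset

/-! ## §1 Under (T) on runs, the runs of `β` are runs of the Markov family read off the law `φ` -/

section Generic

variable {β : HBeta} {φ : ℕ → ℝ → ℝ} {γ : ℝ}

/-- The Markov family read off the law: `ofMarkov (fun m g ↦ φ_{m−1}(g))` at scale `k` reads `φ_k` at the LAST coupling. [folklore] -/
theorem ofMarkov_pred_apply (φ : ℕ → ℝ → ℝ) (k : ℕ) (v : Fin (k + 1) → ℝ) :
    ofMarkov (fun m g => φ (m - 1) g) k v = φ k (v (Fin.last k)) := by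
  simp [ofMarkov]

/-- **(T) ON RUNS ⟹ EVERY IN-WINDOW RUN OF `β` IS A RUN OF THE MARKOV FAMILY** `ofMarkov (fun m g ↦ φ_{m−1}(g))` (same recursion (0.20), step by step, since `β_k(g_0,…,g_k) = φ_k(g_k)`
along the run). [cite: Balaban1987RG1, (0.20) p.256] -/
theorem rgEqH_ofMarkov_of_runReading
    (hR : ∀ (k : ℕ) (gs : ℕ → ℝ), RGEqH k β gs → Step.InInterval γ k gs → β k (prefixOf gs k) = φ k (gs k))
    {n : ℕ} {gs : ℕ → ℝ} (hrg : RGEqH n β gs) (hI : Step.InInterval γ n gs) :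
    RGEqH n (ofMarkov fun m g => φ (m - 1) g) gs := by
  intro k hk
  have h := hrg k hk
  have hRk : β k (prefixOf gs k) = φ k (gs k) :=
    hR k gs (fun j hj => hrg j (lt_trans hj hk)) (fun i hi => hI i (le_trans hi hk.le))
  rw [ofMarkov_pred_apply, prefixOf_apply, Fin.val_last, ← hRk]
  exact h

/-- A Lipschitz constant `L` of the read law in the CURRENT coupling on `]0,γ]` (uniform in the scale) is a LAST-ONLY history modulus of the Markov family. [cite: Balaban1987RG1, §1 p.264] -/
theorem lastOnlyLipschitz_ofMarkov_of_lipschitz {L : ℝ}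
    (hφ : ∀ (k : ℕ) (x y : ℝ), 0 < x → x ≤ γ → 0 < y → y ≤ γ → |φ k x - φ k y| ≤ L * |x - y|) :
    LastOnlyLipschitz L γ (ofMarkov fun m g => φ (m - 1) g) := by
  intro k p q hp hq
  rw [ofMarkov_pred_apply, ofMarkov_pred_apply]
  exact hφ k _ _ (mem_box.mp hp _).1 (mem_box.mp hp _).2 (mem_box.mp hq _).1 (mem_box.mp hq _).2

/-- The Markov scale shift of the read law AT FIXED COUPLING, `|φ_{k+1}(g) − φ_k(g)| ≤ cθ^k` on `]0,γ]`, IS NE4 (`ScaleShiftRate`) of the Markov family (pv16's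
`scaleShiftRate_ofMarkov_iff`). [cite: Balaban1987RG1, (1.20)–(1.22) p.264] -/
theorem scaleShiftRate_ofMarkov_of_markovShift {c θ : ℝ}
    (hs : ∀ (k : ℕ) (g : ℝ), 0 < g → g ≤ γ → |φ (k + 1) g - φ k g| ≤ c * θ ^ k) :
    ScaleShiftRate c θ γ (ofMarkov fun m g => φ (m - 1) g) :=
  scaleShiftRate_ofMarkov_iff.mpr fun k g hg hgγ => by simpa using hs k g hg hgγ

/-- An eventual lower bound `b ≤ φ_k` on `]0,γ]` (`k ≥ k₀`, asymptotic freedom of the read law) is `EventualLowerH b γ k₀` of the Markov family. [cite: Balaban1987RG1, Thm 2 (0.31) p.259] -/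
theorem eventualLowerH_ofMarkov_of_lower {b : ℝ} {k₀ : ℕ}
    (hlo : ∀ (k : ℕ) (g : ℝ), k₀ ≤ k → 0 < g → g ≤ γ → b ≤ φ k g) :
    EventualLowerH b γ k₀ (ofMarkov fun m g => φ (m - 1) g) := by
  intro k v hk hv
  rw [ofMarkov_pred_apply]
  exact hlo k _ hk (mem_box.mp hv _).1 (mem_box.mp hv _).2

/-! ## §2 Node U2's matching for runs of `β`, through pv16's MARKOV Grönwall road (no fading memory, no box letter on histories) -/

/-- ★★ **TWO IR-PINNED IN-WINDOW RUNS OF `β` UNDER (T): node U2's K-uniform matching from the READ LAW's letters only.**  Run A (`K` steps) and run B (`K+1` steps) of (0.20) with `β`,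
couplings in `]0,γ]`, pinned `g^A_K = g^B_{K+1}`; (T) on runs at level `γ`; the read law `L`-Lipschitz in the current coupling with `Lγ³ ≤ ½`; Markov scale shift `cθ^k`, `0 ≤ θ < 1` ⟹
`disc_j ≤ exp(2L·Σ_{m∈[j,K)}(g^A_m)²g^B_{m+1})·(c∕(1−θ))·θ^j` for `j ≤ K` — `T4CouplingMatching.disc_le_of_lastOnly` applied to the Markov family both runs obey (§1).  NO `HistLipschitz` ∕
`FadingMemory` ∕ `ScaleShiftRate` on `β`'s histories is read.  Every letter an UNPRINTED binder. [cite: Balaban1987RG1, (0.20) p.256 and (1.20)–(1.22) p.264] -/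
theorem disc_le_of_runReading_lipschitz_markovShift {c θ L : ℝ} {K : ℕ} {gA gB : ℕ → ℝ}
    (hR : ∀ (k : ℕ) (gs : ℕ → ℝ), RGEqH k β gs → Step.InInterval γ k gs → β k (prefixOf gs k) = φ k (gs k))
    (hφ : ∀ (k : ℕ) (x y : ℝ), 0 < x → x ≤ γ → 0 < y → y ≤ γ → |φ k x - φ k y| ≤ L * |x - y|)
    (hs : ∀ (k : ℕ) (g : ℝ), 0 < g → g ≤ γ → |φ (k + 1) g - φ k g| ≤ c * θ ^ k)
    (hθ0 : 0 ≤ θ) (hθ1 : θ < 1) (hc : 0 ≤ c) (hL0 : 0 ≤ L) (hLγ : L * γ ^ 3 ≤ 1 / 2)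
    (hA : RGEqH K β gA) (hIA : Step.InInterval γ K gA) (hB : RGEqH (K + 1) β gB) (hIB : Step.InInterval γ (K + 1) gB) (hpin : gA K = gB (K + 1)) :
    ∀ j, j ≤ K → disc gA gB j ≤ Real.exp (2 * ∑ m ∈ Ico j K, L * ((gA m) ^ 2 * gB (m + 1))) * (c / (1 - θ) * θ ^ j) :=
  disc_le_of_lastOnly hθ0 hθ1 hc hL0 hLγ (rgEqH_ofMarkov_of_runReading hR hA hIA) (rgEqH_ofMarkov_of_runReading hR hB hIB) hIA hIB hpin
    (scaleShiftRate_ofMarkov_of_markovShift hs) (lastOnlyLipschitz_ofMarkov_of_lipschitz hφ)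

/-- ★★★ **A PINNED FAMILY OF RUNS OF `β` UNDER (T) ⟹ NODE U2's INJECTED RATE, K-UNIFORM** (`T4CouplingMatching.injectedRate_of_runs_lastOnly` on the Markov family): runs `g K` (`K` steps,
all in `]0,γ]`, all pinned at `gIR`), (T) on runs, the read law's Lipschitz ∕ scale-shift letters and an eventual lower bound `b > 0` (for the AF weight sum) ⟹
`InjectedRate (exp(2L((k₀+1)γ³ + 2γ∕b))·c∕(1−θ)) 0 θ (K j ↦ disc (g K) (g (K+1)) j)`. [cite: Balaban1987RG1, (0.20) p.256, Thm 2 (0.31) p.259 and (1.20)–(1.22) p.264] -/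
theorem injectedRate_of_runs_runReading {b c θ L : ℝ} {k₀ : ℕ} (g : ℕ → ℕ → ℝ) (gIR : ℝ)
    (hR : ∀ (k : ℕ) (gs : ℕ → ℝ), RGEqH k β gs → Step.InInterval γ k gs → β k (prefixOf gs k) = φ k (gs k))
    (hφ : ∀ (k : ℕ) (x y : ℝ), 0 < x → x ≤ γ → 0 < y → y ≤ γ → |φ k x - φ k y| ≤ L * |x - y|)
    (hs : ∀ (k : ℕ) (g : ℝ), 0 < g → g ≤ γ → |φ (k + 1) g - φ k g| ≤ c * θ ^ k)
    (hlo : ∀ (k : ℕ) (g : ℝ), k₀ ≤ k → 0 < g → g ≤ γ → b ≤ φ k g)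
    (hγ : 0 < γ) (hb : 0 < b) (hθ0 : 0 < θ) (hθ1 : θ < 1) (hc : 0 ≤ c) (hL0 : 0 ≤ L) (hLγ : L * γ ^ 3 ≤ 1 / 2)
    (hrun : ∀ K, RGEqH K β (g K)) (hbox : ∀ K, Step.InInterval γ K (g K)) (hpin : ∀ K, g K K = gIR) :
    T4CauchySum.InjectedRate (Real.exp (2 * (L * (((k₀ : ℝ) + 1) * γ ^ 3 + 2 * γ / b))) * c / (1 - θ)) 0 θ
      (fun K j => disc (g K) (g (K + 1)) j) :=
  injectedRate_of_runs_lastOnly g gIR hγ hb hθ0 hθ1 hc hL0 hLγ (fun K => rgEqH_ofMarkov_of_runReading hR (hrun K) (hbox K)) hbox hpin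
    (scaleShiftRate_ofMarkov_of_markovShift hs) (lastOnlyLipschitz_ofMarkov_of_lipschitz hφ) (eventualLowerH_ofMarkov_of_lower hlo)

end Generic

/-! ## §3 On the data: node U2's OUTPUT (`Spine.NE4.U2Output`, the N19′ edge's input) from (T) on the runs of `D.βfun` and the read law's letters -/

section Data

universe u

variable {F : T4Family} {G : Type u} [GaugeGroup G] [MeasurableSpace G] [HaarData G]

/-- ★★★ **NODE U2's OUTPUT ON THE DATA FROM THE TRANSPORT READING**: if along every in-window (0.20)-run of the data's β-family at level `γ` the β of scale `k` READS THE CURRENT COUPLING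
through a law `φ_k` that is `L`-Lipschitz on `]0,γ]` (`Lγ³ ≤ ½`), has Markov scale shift `cθ^k` (`0 < θ < 1`) and is eventually `≥ b > 0`; and `g₀` is TUNED to `g` within `]0,γ]`
((0.20) run forward by the printed-type upper bound, `rgEqH_of_tuned`) — THEN `U2Output D g₀ (exp(2L((k₀+1)γ³ + 2γ∕b))·c∕(1−θ)) θ`.  Compare `Spine/NE4/Targets.u2Output_of_u2Inputs`:
there the input is the BOX triple `ScaleShiftRate ∧ HistLipschitz ∧ FadingMemory` on `D.βfun`; here NO letter on `D.βfun`'s histories at all — the F-E-robust (mod (T)) door.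
CONDITIONAL; nothing of Bałaban asserted. [cite: Balaban1987RG1, (0.20) p.256, Thm 2 (0.31) p.259 and (1.20)–(1.22) p.264] -/
theorem u2Output_of_runReading (D : FiniteEpsData F G) {φ : ℕ → ℝ → ℝ} {γ c θ L b β' g : ℝ} {k₀ : ℕ} {g₀ : ℕ → ℝ}
    (hR : ∀ (k : ℕ) (gs : ℕ → ℝ), RGEqH k D.βfun gs → Step.InInterval γ k gs → D.βfun k (prefixOf gs k) = φ k (gs k))
    (hφ : ∀ (k : ℕ) (x y : ℝ), 0 < x → x ≤ γ → 0 < y → y ≤ γ → |φ k x - φ k y| ≤ L * |x - y|)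
    (hs : ∀ (k : ℕ) (g : ℝ), 0 < g → g ≤ γ → |φ (k + 1) g - φ k g| ≤ c * θ ^ k)
    (hlo : ∀ (k : ℕ) (g : ℝ), k₀ ≤ k → 0 < g → g ≤ γ → b ≤ φ k g)
    (hγ : 0 < γ) (hb : 0 < b) (hθ0 : 0 < θ) (hθ1 : θ < 1) (hc : 0 ≤ c) (hL0 : 0 ≤ L) (hLγ : L * γ ^ 3 ≤ 1 / 2)
    (hhi : BetaUpperH β' γ D.βfun) (hγβ : γ ^ 2 * β' < 1) (ht : D.Tuned γ g g₀) :
    U2Output D g₀ (Real.exp (2 * (L * (((k₀ : ℝ) + 1) * γ ^ 3 + 2 * γ / b))) * c / (1 - θ)) θ := by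
  obtain ⟨hbox, hpin⟩ := box_and_pin_of_tuned D ht
  exact injectedRate_of_runs_runReading (runFlow D g₀) g hR hφ hs hlo hγ hb hθ0 hθ1 hc hL0 hLγ
    (fun K => rgEqH_of_tuned D hhi hγβ hγ le_rfl ht K) hbox hpin

end Data

end Summit.QuantumFields.YangMills.BalabanUVNodes.N17U2MarkovDoorOfRunReading

end
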